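import Summits.KontsevichZagierPeriods.KontsevichZagierPeriods.Theses.HurwitzMicroSectors
import Summits.KontsevichZagierPeriods.KontsevichZagierPeriods.Theorems.HurwitzMicroSectorsNormalFormPrinciplePiBoxTransfer
import Summits.KontsevichZagierPeriods.KontsevichZagierPeriods.Theorems.HurwitzMicroSectorsNormalFormPrincipleVariants2305

/-! TTRL-lite variant V2306 of stmt-KontsevichZagierPeriods-3869

Variant V2306 = `stub_boxRigidity` (the leaf `BoxRigidity` of `NormalFormPrinciple`: two representations
on open unit boxes with integrands of KZ's rational shape `p/q` over `ℚ` and equal values are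
KZ-equivalent) under the two-sided move `bound_nat:m≤6; bound_nat:m'≤3`. Verdict of the attempt seat:
**open** — this file is the exact-strength certificate, not a proof of the variant. With
`BoxVanishing K` := "a box-rational representation of dimension `K` and value `0` is a relation", the
tree's graded lemmas (`boxVanishingDim_left_of_pair`, `boxRigidityLe_of_boxVanishingDim`, file
`…Variants2238`) pin the variant exactly:
`V2306 ⟺ BoxVanishing 6 ⟺ BoxRigidity for all m, m' ≤ 6 ⟺ V2305 (fix m = 6; m' ≤ 3) ⟺ V2302 (fix m = 6; m' ≤ 2)`,
so bounding `m ≤ 6` instead of freezing `m = 6` changes nothing. `BoxVanishing 6` contains, e.g.,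
"for `a b : ℚ`, `a + b·ζ(5) = 0 ⇒ [a + b/(1 − x₁⋯x₅)]_{(0,1)⁶}` is a relation" and (via
`boxVanishingDim_mono`) the Catalan dichotomy "`G = q ⇒ [1/(1+x²y²) − q]_{(0,1)²}` is a relation for every
`q : ℚ`", provable today only through open irrationality statements or an explicit chain of moves (none
can exist unless the number is rational, by soundness); conversely `KontsevichZagierPeriods → V2306`
(`stub_boxRigidity_var2306_of_statement`), so a refutation of the variant would refute the Summit, and
the tree has no invariant of `KZ.relations` finer than `KZ.eval`. Source: M. Kontsevich, D. Zagier,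
*Periods* (2001), §1.2 Conjecture 1. Pure proof file, no definitions. -/

-- `Summit.<Summit>.<Problem>` is the tree's mandated summit-side namespace (CONVENTIONS §2); for this
-- single-conjunct summit the two coincide, so the duplicate is deliberate.
set_option linter.dupNamespace false

noncomputable section

namespace Summit.KontsevichZagierPeriods.KontsevichZagierPeriods.Theorems

open MeasureTheory Set
open Literature.NumberTheory.Transcendental Literature.NumberTheory.Transcendental.KZ
open Summit.KontsevichZagierPeriods.KontsevichZagierPeriods.Theses.HurwitzMicroSectors
open Summit.KontsevichZagierPeriods.HurwitzMicroSectors.NormalFormPrinciple.PiBox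

/-- **V2306 ⟺ `BoxVanishing 6`**: (⇒) the pair `(6, 0)` is allowed (`6 ≤ 6`, `0 ≤ 3`), so compare a
vanishing box-rational representation on `(0,1)⁶` with the zero representation on the point
(`boxVanishingDim_left_of_pair`); (⇐) `boxRigidityLe_of_boxVanishingDim 6` with `m ≤ 6`, `m' ≤ 3 ≤ 6`.
[cite: KontsevichZagier2001, §1.2 Conjecture 1] -/
theorem stub_boxRigidity_var2306_iff_boxVanishing_six :
    (∀ (m m' : ℕ) (N : IntegralRep m) (N' : IntegralRep m'), m' ≤ 3 → m ≤ 6 → N.domain = {x | ∀ i, x i ∈ Set.Ioo (0:ℝ) 1} → N.IsRational → N'.domain = {x | ∀ i, x i ∈ Set.Ioo (0:ℝ) 1} → N'.IsRational → N.value = N'.value → Equivalent N N') ↔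
    (∀ (M : IntegralRep 6), M.domain = {x | ∀ i, x i ∈ Set.Ioo (0:ℝ) 1} → M.IsRational →
      M.value = 0 → of M ∈ relations) :=
  ⟨fun h => boxVanishingDim_left_of_pair 6 0 fun N N' => h 6 0 N N' (Nat.zero_le 3) le_rfl,
    fun hvan m m' N N' hm' hm =>
      boxRigidityLe_of_boxVanishingDim 6 hvan m m' N N' hm (hm'.trans (by norm_num))⟩

/-- **V2306 ⟺ the sibling V2305** (`fix_nat:m=6; bound_nat:m'≤3`): both are `BoxVanishing 6`
(`stub_boxRigidity_var2305_iff_boxVanishing_six`), so bounding `m ≤ 6` instead of freezing `m = 6`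
adds nothing. [cite: KontsevichZagier2001, §1.2 Conjecture 1] -/
theorem stub_boxRigidity_var2306_iff_var2305 :
    (∀ (m m' : ℕ) (N : IntegralRep m) (N' : IntegralRep m'), m' ≤ 3 → m ≤ 6 → N.domain = {x | ∀ i, x i ∈ Set.Ioo (0:ℝ) 1} → N.IsRational → N'.domain = {x | ∀ i, x i ∈ Set.Ioo (0:ℝ) 1} → N'.IsRational → N.value = N'.value → Equivalent N N') ↔
    (∀ (m' : ℕ) (N : IntegralRep 6) (N' : IntegralRep m'), m' ≤ 3 → N.domain = {x | ∀ i, x i ∈ Set.Ioo (0:ℝ) 1} → N.IsRational → N'.domain = {x | ∀ i, x i ∈ Set.Ioo (0:ℝ) 1} → N'.IsRational → N.value = N'.value → Equivalent N N') := by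
  rw [stub_boxRigidity_var2306_iff_boxVanishing_six, stub_boxRigidity_var2305_iff_boxVanishing_six]

/-- **V2306 ⟺ the sibling V2302** (`fix_nat:m=6; bound_nat:m'≤2`): both are `BoxVanishing 6`
(`stub_boxRigidity_var2302_iff_boxVanishing_six`). [cite: KontsevichZagier2001, §1.2 Conjecture 1] -/
theorem stub_boxRigidity_var2306_iff_var2302 :
    (∀ (m m' : ℕ) (N : IntegralRep m) (N' : IntegralRep m'), m' ≤ 3 → m ≤ 6 → N.domain = {x | ∀ i, x i ∈ Set.Ioo (0:ℝ) 1} → N.IsRational → N'.domain = {x | ∀ i, x i ∈ Set.Ioo (0:ℝ) 1} → N'.IsRational → N.value = N'.value → Equivalent N N') ↔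
    (∀ (m' : ℕ) (N : IntegralRep 6) (N' : IntegralRep m'), m' ≤ 2 → N.domain = {x | ∀ i, x i ∈ Set.Ioo (0:ℝ) 1} → N.IsRational → N'.domain = {x | ∀ i, x i ∈ Set.Ioo (0:ℝ) 1} → N'.IsRational → N.value = N'.value → Equivalent N N') := by
  rw [stub_boxRigidity_var2306_iff_boxVanishing_six, stub_boxRigidity_var2302_iff_boxVanishing_six]

/-- **V2306 ⟺ `BoxRigidity` for all `m, m' ≤ 6`** (the honest strength of the variant: Conjecture 1 for
all pairs of rational integrands on the open unit boxes of dimension at most `6`; in particular the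
asymmetric bound `m' ≤ 3` is not a weakening). [cite: KontsevichZagier2001, §1.2 Conjecture 1] -/
theorem stub_boxRigidity_var2306_iff_le_six :
    (∀ (m m' : ℕ) (N : IntegralRep m) (N' : IntegralRep m'), m' ≤ 3 → m ≤ 6 → N.domain = {x | ∀ i, x i ∈ Set.Ioo (0:ℝ) 1} → N.IsRational → N'.domain = {x | ∀ i, x i ∈ Set.Ioo (0:ℝ) 1} → N'.IsRational → N.value = N'.value → Equivalent N N') ↔
    (∀ (m m' : ℕ) (N : IntegralRep m) (N' : IntegralRep m'), m ≤ 6 → m' ≤ 6 →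
      N.domain = {x | ∀ i, x i ∈ Set.Ioo (0:ℝ) 1} → N.IsRational →
      N'.domain = {x | ∀ i, x i ∈ Set.Ioo (0:ℝ) 1} → N'.IsRational →
      N.value = N'.value → Equivalent N N') := by
  rw [stub_boxRigidity_var2306_iff_var2302]
  exact stub_boxRigidity_var2302_iff_le_six

/-- **V2306 gives `BoxVanishing j` for every `j ≤ 6`** (`boxVanishingDim_mono`): in particular the
dimension-`2` (Catalan) and dimension-`5` (`ζ(5)`) dichotomies quoted in the file docstring.
[cite: KontsevichZagier2001, §1.2 Conjecture 1] -/
theorem boxVanishing_le_six_of_stub_boxRigidity_var2306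
    (h : ∀ (m m' : ℕ) (N : IntegralRep m) (N' : IntegralRep m'), m' ≤ 3 → m ≤ 6 → N.domain = {x | ∀ i, x i ∈ Set.Ioo (0:ℝ) 1} → N.IsRational → N'.domain = {x | ∀ i, x i ∈ Set.Ioo (0:ℝ) 1} → N'.IsRational → N.value = N'.value → Equivalent N N')
    {j : ℕ} (hj : j ≤ 6) :
    ∀ (M : IntegralRep j), M.domain = {x | ∀ i, x i ∈ Set.Ioo (0:ℝ) 1} → M.IsRational →
      M.value = 0 → of M ∈ relations :=
  boxVanishingDim_mono hj (stub_boxRigidity_var2306_iff_boxVanishing_six.1 h)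

/-- **`BoxVanishing 6` alone already proves V2306** (the residual of the variant, stated as the
missing lemma). [cite: KontsevichZagier2001, §1.2 Conjecture 1] -/
theorem stub_boxRigidity_var2306_of_boxVanishing_six
    (hvan : ∀ (M : IntegralRep 6), M.domain = {x | ∀ i, x i ∈ Set.Ioo (0:ℝ) 1} → M.IsRational →
      M.value = 0 → of M ∈ relations) :
    ∀ (m m' : ℕ) (N : IntegralRep m) (N' : IntegralRep m'), m' ≤ 3 → m ≤ 6 → N.domain = {x | ∀ i, x i ∈ Set.Ioo (0:ℝ) 1} → N.IsRational → N'.domain = {x | ∀ i, x i ∈ Set.Ioo (0:ℝ) 1} → N'.IsRational → N.value = N'.value → Equivalent N N' :=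
  stub_boxRigidity_var2306_iff_boxVanishing_six.2 hvan

/-- **The parent leaf ⇒ V2306** (drop both bounds). [cite: KontsevichZagier2001, §1.2 Conjecture 1] -/
theorem stub_boxRigidity_var2306_of_parent
    (h : ∀ (m m' : ℕ) (N : IntegralRep m) (N' : IntegralRep m'), N.domain = {x | ∀ i, x i ∈ Set.Ioo (0:ℝ) 1} → N.IsRational → N'.domain = {x | ∀ i, x i ∈ Set.Ioo (0:ℝ) 1} → N'.IsRational → N.value = N'.value → Equivalent N N') :
    ∀ (m m' : ℕ) (N : IntegralRep m) (N' : IntegralRep m'), m' ≤ 3 → m ≤ 6 → N.domain = {x | ∀ i, x i ∈ Set.Ioo (0:ℝ) 1} → N.IsRational → N'.domain = {x | ∀ i, x i ∈ Set.Ioo (0:ℝ) 1} → N'.IsRational → N.value = N'.value → Equivalent N N' :=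
  fun m m' N N' _ _ => h m m' N N'

/-- **`KontsevichZagierPeriods ⇒ V2306`**: the variant is a special case of Conjecture 1 for the
tree's calculus (`leaves_of_statement`) — so a refutation of the variant would refute the Summit.
[cite: KontsevichZagier2001, §1.2 Conjecture 1] -/
theorem stub_boxRigidity_var2306_of_statement (h : _root_.KontsevichZagierPeriods) :
    ∀ (m m' : ℕ) (N : IntegralRep m) (N' : IntegralRep m'), m' ≤ 3 → m ≤ 6 → N.domain = {x | ∀ i, x i ∈ Set.Ioo (0:ℝ) 1} → N.IsRational → N'.domain = {x | ∀ i, x i ∈ Set.Ioo (0:ℝ) 1} → N'.IsRational → N.value = N'.value → Equivalent N N' :=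
  stub_boxRigidity_var2306_of_parent (leaves_of_statement h).1

end Summit.KontsevichZagierPeriods.KontsevichZagierPeriods.Theorems

end
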